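import Summits.MatrixMultiplication.OmegaCensus.SmallFormats.MatMul22nRankGF7ThreeNPlusFourReduction
import Summits.MatrixMultiplication.OmegaCensus.SmallFormats.MatMul22nRankGF7Slack3Counting
import Summits.MatrixMultiplication.OmegaCensus.SmallFormats.MatMul22nRankGF7Slack3Rect2
import Summits.MatrixMultiplication.OmegaCensus.SmallFormats.MatMul22nRankGF7Slack3ParityBound
import Summits.MatrixMultiplication.OmegaCensus.SmallFormats.MatMul22nRankGF7Slack3IdentityData1
import Summits.MatrixMultiplication.OmegaCensus.SmallFormats.MatMul22nRankGF7Slack3IdentityData2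
import Summits.MatrixMultiplication.OmegaCensus.SmallFormats.MatMul22nRankGF7Slack3IdentityData3
import Summits.MatrixMultiplication.OmegaCensus.SmallFormats.MatMul22nRankGF7Slack3IdentityData4
import Summits.MatrixMultiplication.OmegaCensus.SmallFormats.MatMul22nRankGF7Slack3IdentityData5
import Summits.MatrixMultiplication.OmegaCensus.SmallFormats.MatMul22nRankGF7Slack3IdentityData6
import Summits.MatrixMultiplication.OmegaCensus.SmallFormats.MatMul22nRankGF7Slack3IdentityData7
import Summits.MatrixMultiplication.OmegaCensus.SmallFormats.MatMul22nRankGF7Slack3IdentityData8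
import HarnessLib

/-!
# ω-census family (a): `M₇(3) ≤ 155` — no LP-tight point of the slack-3 `𝔽₇` X-cap system; `R_𝔽₇(⟨2,2,n⟩) ≥ 3n + 4` for `n ≥ 51`

Cell `pub-omega` (unit `pub-omega-tensor-g13`), topic `Summits/MatrixMultiplication/OmegaCensus` (sub-folder `SmallFormats`).
Framing (verbatim): lottery ticket; floor = certified bounds/negative ranges. HONEST FRAMING: ONE census cell beyond the tree's
`𝔽₇` floor (`3n + 3` for `n ≥ 33`, `MatMul22nRankGF7ThreeNPlusThreeFrom33`): here `3n + 4` for every `n ≥ 51` (all orientations),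
cell `n = 51`: `157 ≤ R_𝔽₇(⟨2,2,51⟩)`. A statement about the X-cap counting RELAXATION made sharp; nothing here is progress on `ω`.

PROOF (`pub-omega-tensor-g13/METHOD-MOMENT-g13.md`). A point `x` of the 1274 symmetric rows of `xcapSys7s 3` in `[0,3]^401` with total
`≥ 156` is TIGHT: `z = 0`, every tangent row `= 3`, every row-plane row `= 6` (`tight_count7`). For every invertible class `g` the
kernel-checked LOCAL IDENTITY (`MatMul22nRankGF7Slack3Cert.ident7_of_identOK7` with the certificates of `…IdentityData1–8`)
`224·x g + 28·μ[g] − 8·Π[g] + 192 = Σ_r ν_r·(row_r − rhs_r) = 0` and the 21 passant caps `Π[g] ≤ 63` give `8·x g + μ[g] ≤ 11` and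
`μ[g]` even (`μ[g]` = the rank-one part of `x` summed along the graph of `g`). Evenness along all graphs gives rectangle parity of the
`8 × 8` rank-one matrix `μ` (`…Rect1/2`), whose rows and columns sum to `6` (`ruling_sum7`, `cell_sum7`), so `Σ μ(3−μ) ≥ 48`
(`parity_bound7`). But `Σ_g x g·μ[g] = Σ_{w,i} μ(w,i)·(18 − 6μ(w,i)) = 6·Σ μ(3−μ) ≥ 288` (cells), while pointwise
`x g·μ[g] ≤ 2·x g` gives `≤ 216`. Contradiction; hence `NoTightPoint7 3 156` and, by `three_mul_add_four_le_of_noTightPoint7`, the bound.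
-/

namespace Summit.MatrixMultiplication.OmegaCensus.SmallFormats

open Finset Literature.Computability.AlgebraicComplexity

/-- Every invertible class `g < 400` has a passing local-identity certificate. -/
theorem identOK7_ex {g : ℕ} (hg : g < 400) (hinv : isInv7 g = true) : ∃ W, identOK7 g W = true := by
  by_cases h1 : g < 58
  · exact identOK7_ex_1 g (Nat.zero_le _) h1 hinv
  by_cases h2 : g < 107
  · exact identOK7_ex_2 g (by omega) h2 hinv
  by_cases h3 : g < 156
  · exact identOK7_ex_3 g (by omega) h3 hinv
  by_cases h4 : g < 205
  · exact identOK7_ex_4 g (by omega) h4 hinv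
  by_cases h5 : g < 254
  · exact identOK7_ex_5 g (by omega) h5 hinv
  by_cases h6 : g < 303
  · exact identOK7_ex_6 g (by omega) h6 hinv
  by_cases h7 : g < 352
  · exact identOK7_ex_7 g (by omega) h7 hinv
  exact identOK7_ex_8 g (by omega) hg hinv

/-- **Local step.** At a tight point the identity at `g` and the 21 passant caps give `8·x g + μ[g] ≤ 11` and `μ[g]` even. -/
theorem local7 {g W : ℕ} (hg : g < 400) (hW : identOK7 g W = true) (x : ℕ → ℕ)
    (hT : ∀ r < 384, xrs7 x r = 3) (hR : ∀ k < 8, xrs7 x (1266 + k) = 6)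
    (hP : ∀ r, 384 ≤ r → r < 1266 → xrs7 x r ≤ 3) :
    8 * (x g : ℤ) + muTr7 x g ≤ 11 ∧ muTr7 x g % 2 = 0 := by
  have hid := ident7_of_identOK7 hg hW x
  have hzero : ∑ r ∈ range 1274, nuW7 W r * (xrs7 x r - (rhsN7 r : ℤ)) = 0 := by
    refine sum_eq_zero fun r hr => ?_
    have hr' := mem_range.1 hr
    by_cases h384 : r < 384
    · rw [hT r h384]; simp [rhsN7, show r < 1266 by omega]
    by_cases h1266 : r < 1266
    · rw [nuW7_passant_of_identOK7 hW (by omega) h1266, zero_mul]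
    · obtain ⟨k, hk, rfl⟩ : ∃ k < 8, r = 1266 + k := ⟨r - 1266, by omega, by omega⟩
      rw [hR k hk]; simp [rhsN7]
  have hPi : piW7 x W ≤ 63 := by
    unfold piW7
    have hle : ∀ r ∈ range 1274, (mark7 W r : ℤ) * xrs7 x r ≤ (mark7 W r : ℤ) * 3 := by
      intro r hr
      by_cases hm : mark7 W r = 0
      · rw [hm]; simp
      · obtain ⟨h1, h2⟩ := marks7_range_of_identOK7 hW (mem_range.1 hr) hm
        have := mark7_le_one W r
        have h3 := hP r h1 h2
        have hm1 : mark7 W r = 1 := by omega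
        rw [hm1]; push_cast; linarith
    have hs := marks7_sum_of_identOK7 hW
    have h63 : ∑ r ∈ range 1274, (mark7 W r : ℤ) * 3 = 63 := by rw [← sum_mul, hs]; norm_num
    linarith [sum_le_sum hle, h63]
  have hmu0 : 0 ≤ muTr7 x g := sum_nonneg fun i _ => Int.natCast_nonneg _
  rw [hzero] at hid
  constructor <;> omega

/-- Pointwise consequence used in the final count: `a · m ≤ 2 · a` from `8a + m ≤ 11`, `m` even, `m ≥ 0`, `a ≤ 3`. -/
theorem mul_le_two_mul_of_local7 {a : ℕ} (ha : a ≤ 3) {m : ℤ} (h : 8 * (a : ℤ) + m ≤ 11) (hev : m % 2 = 0)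
    (h0 : 0 ≤ m) : (a : ℤ) * m ≤ 2 * (a : ℤ) := by
  interval_cases a <;> push_cast at h ⊢ <;> omega

/-- **`M₇(3) ≤ 155`: the slack-3 `𝔽₇` X-cap system has no point of total `≥ 156`.** -/
theorem noTightPoint7_3_156 : NoTightPoint7 3 156 := by
  intro x hbox hrows
  by_contra hge'
  have hge : (156 : ℤ) ≤ ∑ j ∈ range 401, (x j : ℤ) := by have := not_lt.mp hge'; exact_mod_cast this
  -- rows through the row lists
  have hrow : ∀ r < 1274, xrs7 x r + (x 400 : ℤ) ≤ rhs7s 3 r := by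
    intro r hr
    have h := hrows r hr
    unfold capRowVal7 at h
    rwa [capRow_eq_xrs7 x hr] at h
  have hrhs3 : ∀ r < 1266, rhs7s 3 r = 3 := fun r hr => by simp [rhs7s, hr]
  have hrhs6 : ∀ r, 1266 ≤ r → r < 1274 → rhs7s 3 r = 6 := fun r h1 h2 => by
    simp [rhs7s, show ¬ r < 1266 by omega, h2]
  -- tightness
  have hTot : ∑ j ∈ range 401, (x j : ℤ) = ∑ j ∈ range 400, (x j : ℤ) + (x 400 : ℤ) := sum_range_succ _ _
  have hcount := tight_count7 x
  have hS1 : ∑ r ∈ range 384, xrs7 x r ≤ ∑ r ∈ range 384, (3 - (x 400 : ℤ)) :=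
    sum_le_sum fun r hr => by have := hrow r (by have := mem_range.1 hr; omega); rw [hrhs3 r (by have := mem_range.1 hr; omega)] at this; linarith
  have hS2 : ∑ k ∈ range 8, xrs7 x (1266 + k) ≤ ∑ k ∈ range 8, (6 - (x 400 : ℤ)) :=
    sum_le_sum fun k hk => by
      have hk' := mem_range.1 hk
      have := hrow (1266 + k) (by omega); rw [hrhs6 (1266 + k) (by omega) (by omega)] at this; linarith
  have hz : x 400 = 0 := by
    have h1 : ∑ r ∈ range 384, (3 - (x 400 : ℤ)) = 384 * (3 - (x 400 : ℤ)) := by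
      rw [sum_const, card_range, nsmul_eq_mul]; push_cast; ring
    have h2 : ∑ k ∈ range 8, (6 - (x 400 : ℤ)) = 8 * (6 - (x 400 : ℤ)) := by
      rw [sum_const, card_range, nsmul_eq_mul]; push_cast; ring
    have h0 : (0 : ℤ) ≤ (x 400 : ℤ) := Int.natCast_nonneg _
    have hzle : (x 400 : ℤ) ≤ 0 := by linarith [hS1, hS2, hcount, hTot, hge, h1, h2]
    have : x 400 ≤ 0 := by exact_mod_cast hzle
    omega
  simp only [hz, Nat.cast_zero, sub_zero, add_zero] at hS1 hS2 hrow hTot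
  have h1152 : ∑ r ∈ range 384, (3 : ℤ) = 1152 := by rw [sum_const, card_range, nsmul_eq_mul]; norm_num
  have h48 : ∑ k ∈ range 8, (6 : ℤ) = 48 := by rw [sum_const, card_range, nsmul_eq_mul]; norm_num
  have hS1eq : ∑ r ∈ range 384, xrs7 x r = ∑ r ∈ range 384, (3 : ℤ) := by
    apply le_antisymm hS1
    linarith [hS2, hcount, hTot, hge, h1152, h48]
  have hS2eq : ∑ k ∈ range 8, xrs7 x (1266 + k) = ∑ k ∈ range 8, (6 : ℤ) := by
    apply le_antisymm hS2
    linarith [hS1, hcount, hTot, hge, h1152, h48]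
  have hT : ∀ r < 384, xrs7 x r = 3 := by
    have := (sum_eq_sum_iff_of_le (fun r hr => by
      have := hrow r (by have := mem_range.1 hr; omega); rw [hrhs3 r (by have := mem_range.1 hr; omega)] at this; exact this)).1 hS1eq
    exact fun r hr => this r (mem_range.2 hr)
  have hR : ∀ k < 8, xrs7 x (1266 + k) = 6 := by
    have := (sum_eq_sum_iff_of_le (fun k hk => by
      have hk' := mem_range.1 hk
      have := hrow (1266 + k) (by omega); rw [hrhs6 (1266 + k) (by omega) (by omega)] at this; exact this)).1 hS2eq
    exact fun k hk => this k (mem_range.2 hk)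
  have hP : ∀ r, 384 ≤ r → r < 1266 → xrs7 x r ≤ 3 := fun r h1 h2 => by
    have := hrow r (by omega); rw [hrhs3 r h2] at this; exact this
  have hTot156 : ∑ j ∈ range 400, (x j : ℤ) = 156 := by
    linarith [hcount, hS1eq, hS2eq, hTot, hge, h1152, h48]
  -- the rank-one matrix μ
  set μ : ℕ → ℕ → ℕ := fun w i => x (p7 w i) with hμ
  have hμ3 : ∀ w i, w < 8 → i < 8 → μ w i ≤ 3 := fun w i _ _ => hbox _
  have hμrow : ∀ w < 8, ∑ i ∈ range 8, μ w i = 6 := by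
    intro w hw
    have h := ruling_sum7 x hw
    rw [hR w hw] at h
    have h' : ((∑ i ∈ range 8, μ w i : ℕ) : ℤ) = 6 := by push_cast; simp only [hμ]; exact h.symm
    exact_mod_cast h'
  -- cell sums: fiber sums of the invertible classes
  have hfib : ∀ w i, w < 8 → i < 8 →
      ∑ g ∈ (range 400).filter (fun g => isInv7 g = true ∧ perm7 g i = w), (x g : ℤ) = 18 - 6 * (μ w i : ℤ) := by
    intro w i hw hi
    obtain ⟨hcell, hsix⟩ := cell_sum7 x hw hi
    set cw : ℕ → ℕ := fun r => if r < 384 ∧ p7 w i ∈ rowList7 r then 1 else 0 with hcw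
    -- the left side is 3 · (number of rows of the cell) = 18
    have hl : ∑ r ∈ range 1274, ((cw r : ℕ) : ℤ) * xrs7 x r = 3 * (wcoef7 cw (p7 w i) : ℤ) := by
      unfold wcoef7
      push_cast
      rw [mul_sum]
      refine sum_congr rfl fun r hr => ?_
      by_cases hc : r < 384 ∧ p7 w i ∈ rowList7 r
      · have hcnt : cnt7 r (p7 w i) = 1 := by
          unfold cnt7; exact List.count_eq_one_of_mem (rowList7_ok ⟨r, mem_range.1 hr⟩).1 hc.2
        norm_num [hcw, if_pos hc, hcnt, hT r hc.1]
      · simp [hcw, if_neg hc]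
    rw [hl, hsix] at hcell
    push_cast at hcell
    simp only [hμ]
    linarith
  -- invertible total and column sums
  have hrank := rankOne_sum7 x
  have hInv : ∑ g ∈ (range 400).filter (fun g => isInv7 g = true), (x g : ℤ) = 108 := by
    have hsplit := (sum_filter_add_sum_filter_not (range 400) (fun g => isInv7 g = true) (fun g => (x g : ℤ)))
    have hnot : ∑ g ∈ (range 400).filter (fun g => ¬ isInv7 g = true), (x g : ℤ)
        = ∑ g ∈ (range 400).filter (fun g => isInv7 g = false), (x g : ℤ) := by
      refine sum_congr ?_ fun _ _ => rfl
      ext g; simp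
    have h48' : ∑ w ∈ range 8, ∑ i ∈ range 8, (x (p7 w i) : ℤ) = 48 := by
      have : ∀ w ∈ range 8, ∑ i ∈ range 8, (x (p7 w i) : ℤ) = 6 := by
        intro w hw
        have := hμrow w (mem_range.1 hw)
        simp only [hμ] at this
        exact_mod_cast this
      rw [sum_congr rfl this, sum_const, card_range, nsmul_eq_mul]; norm_num
    rw [hnot, hrank, h48'] at hsplit
    linarith
  have hμcol : ∀ i < 8, ∑ w ∈ range 8, μ w i = 6 := by
    intro i hi
    have hpart : ∑ w ∈ range 8, ∑ g ∈ (range 400).filter (fun g => isInv7 g = true ∧ perm7 g i = w), (x g : ℤ)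
        = ∑ g ∈ (range 400).filter (fun g => isInv7 g = true), (x g : ℤ) := by
      rw [← sum_fiberwise_of_maps_to (s := (range 400).filter (fun g => isInv7 g = true)) (t := range 8)
        (g := fun g => perm7 g i) (fun g _ => mem_range.2 (perm7_lt g i))]
      refine sum_congr rfl fun w _ => sum_congr ?_ fun _ _ => rfl
      ext g; simp [and_assoc]
    rw [hInv, sum_congr rfl fun w hw => hfib w i (mem_range.1 hw) hi] at hpart
    have h144 : ∑ w ∈ range 8, (18 - 6 * (μ w i : ℤ)) = 144 - 6 * ∑ w ∈ range 8, (μ w i : ℤ) := by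
      rw [sum_sub_distrib, mul_sum]; simp
    rw [h144] at hpart
    have : ((∑ w ∈ range 8, μ w i : ℕ) : ℤ) = 6 := by push_cast; linarith
    exact_mod_cast this
  -- local facts for every invertible class
  have hloc : ∀ g < 400, isInv7 g = true → 8 * (x g : ℤ) + muTr7 x g ≤ 11 ∧ muTr7 x g % 2 = 0 := by
    intro g hg hinv
    obtain ⟨W, hW⟩ := identOK7_ex hg hinv
    exact local7 hg hW x hT hR hP
  have hμtr : ∀ g, muTr7 x g = ∑ i ∈ range 8, (μ (perm7 g i) i : ℤ) := fun g => rfl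
  -- rectangle parity of μ
  have hrect : ∀ w i, w < 8 → i < 8 → (μ w i + μ w 0 + μ 0 i + μ 0 0) % 2 = 0 := by
    have hev : ∀ S : List ℕ, (∀ g ∈ S, g < 400 ∧ isInv7 g = true) → ∀ g ∈ S, (∑ i ∈ range 8, μ (perm7 g i) i) % 2 = 0 := by
      intro S hS g hg
      obtain ⟨h1, h2⟩ := hS g hg
      have := (hloc g h1 h2).2
      rw [hμtr g] at this
      have hc : ((∑ i ∈ range 8, μ (perm7 g i) i : ℕ) : ℤ) % 2 = 0 := by push_cast; exact this
      omega
    intro w i hw hi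
    by_cases hw0 : w = 0
    · subst hw0; omega
    by_cases hi0 : i = 0
    · subst hi0; omega
    have hw1 : 0 < w := Nat.pos_of_ne_zero hw0
    have hi1 : 0 < i := Nat.pos_of_ne_zero hi0
    interval_cases w <;> interval_cases i
    · exact rect_parity_of_cert7 _ hw1 hw hi1 hi rectCert7_1_1 μ (hev _ rectCertInv7_1_1)
    · exact rect_parity_of_cert7 _ hw1 hw hi1 hi rectCert7_1_2 μ (hev _ rectCertInv7_1_2)
    · exact rect_parity_of_cert7 _ hw1 hw hi1 hi rectCert7_1_3 μ (hev _ rectCertInv7_1_3)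
    · exact rect_parity_of_cert7 _ hw1 hw hi1 hi rectCert7_1_4 μ (hev _ rectCertInv7_1_4)
    · exact rect_parity_of_cert7 _ hw1 hw hi1 hi rectCert7_1_5 μ (hev _ rectCertInv7_1_5)
    · exact rect_parity_of_cert7 _ hw1 hw hi1 hi rectCert7_1_6 μ (hev _ rectCertInv7_1_6)
    · exact rect_parity_of_cert7 _ hw1 hw hi1 hi rectCert7_1_7 μ (hev _ rectCertInv7_1_7)
    · exact rect_parity_of_cert7 _ hw1 hw hi1 hi rectCert7_2_1 μ (hev _ rectCertInv7_2_1)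
    · exact rect_parity_of_cert7 _ hw1 hw hi1 hi rectCert7_2_2 μ (hev _ rectCertInv7_2_2)
    · exact rect_parity_of_cert7 _ hw1 hw hi1 hi rectCert7_2_3 μ (hev _ rectCertInv7_2_3)
    · exact rect_parity_of_cert7 _ hw1 hw hi1 hi rectCert7_2_4 μ (hev _ rectCertInv7_2_4)
    · exact rect_parity_of_cert7 _ hw1 hw hi1 hi rectCert7_2_5 μ (hev _ rectCertInv7_2_5)
    · exact rect_parity_of_cert7 _ hw1 hw hi1 hi rectCert7_2_6 μ (hev _ rectCertInv7_2_6)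
    · exact rect_parity_of_cert7 _ hw1 hw hi1 hi rectCert7_2_7 μ (hev _ rectCertInv7_2_7)
    · exact rect_parity_of_cert7 _ hw1 hw hi1 hi rectCert7_3_1 μ (hev _ rectCertInv7_3_1)
    · exact rect_parity_of_cert7 _ hw1 hw hi1 hi rectCert7_3_2 μ (hev _ rectCertInv7_3_2)
    · exact rect_parity_of_cert7 _ hw1 hw hi1 hi rectCert7_3_3 μ (hev _ rectCertInv7_3_3)
    · exact rect_parity_of_cert7 _ hw1 hw hi1 hi rectCert7_3_4 μ (hev _ rectCertInv7_3_4)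
    · exact rect_parity_of_cert7 _ hw1 hw hi1 hi rectCert7_3_5 μ (hev _ rectCertInv7_3_5)
    · exact rect_parity_of_cert7 _ hw1 hw hi1 hi rectCert7_3_6 μ (hev _ rectCertInv7_3_6)
    · exact rect_parity_of_cert7 _ hw1 hw hi1 hi rectCert7_3_7 μ (hev _ rectCertInv7_3_7)
    · exact rect_parity_of_cert7 _ hw1 hw hi1 hi rectCert7_4_1 μ (hev _ rectCertInv7_4_1)
    · exact rect_parity_of_cert7 _ hw1 hw hi1 hi rectCert7_4_2 μ (hev _ rectCertInv7_4_2)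
    · exact rect_parity_of_cert7 _ hw1 hw hi1 hi rectCert7_4_3 μ (hev _ rectCertInv7_4_3)
    · exact rect_parity_of_cert7 _ hw1 hw hi1 hi rectCert7_4_4 μ (hev _ rectCertInv7_4_4)
    · exact rect_parity_of_cert7 _ hw1 hw hi1 hi rectCert7_4_5 μ (hev _ rectCertInv7_4_5)
    · exact rect_parity_of_cert7 _ hw1 hw hi1 hi rectCert7_4_6 μ (hev _ rectCertInv7_4_6)
    · exact rect_parity_of_cert7 _ hw1 hw hi1 hi rectCert7_4_7 μ (hev _ rectCertInv7_4_7)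
    · exact rect_parity_of_cert7 _ hw1 hw hi1 hi rectCert7_5_1 μ (hev _ rectCertInv7_5_1)
    · exact rect_parity_of_cert7 _ hw1 hw hi1 hi rectCert7_5_2 μ (hev _ rectCertInv7_5_2)
    · exact rect_parity_of_cert7 _ hw1 hw hi1 hi rectCert7_5_3 μ (hev _ rectCertInv7_5_3)
    · exact rect_parity_of_cert7 _ hw1 hw hi1 hi rectCert7_5_4 μ (hev _ rectCertInv7_5_4)
    · exact rect_parity_of_cert7 _ hw1 hw hi1 hi rectCert7_5_5 μ (hev _ rectCertInv7_5_5)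
    · exact rect_parity_of_cert7 _ hw1 hw hi1 hi rectCert7_5_6 μ (hev _ rectCertInv7_5_6)
    · exact rect_parity_of_cert7 _ hw1 hw hi1 hi rectCert7_5_7 μ (hev _ rectCertInv7_5_7)
    · exact rect_parity_of_cert7 _ hw1 hw hi1 hi rectCert7_6_1 μ (hev _ rectCertInv7_6_1)
    · exact rect_parity_of_cert7 _ hw1 hw hi1 hi rectCert7_6_2 μ (hev _ rectCertInv7_6_2)
    · exact rect_parity_of_cert7 _ hw1 hw hi1 hi rectCert7_6_3 μ (hev _ rectCertInv7_6_3)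
    · exact rect_parity_of_cert7 _ hw1 hw hi1 hi rectCert7_6_4 μ (hev _ rectCertInv7_6_4)
    · exact rect_parity_of_cert7 _ hw1 hw hi1 hi rectCert7_6_5 μ (hev _ rectCertInv7_6_5)
    · exact rect_parity_of_cert7 _ hw1 hw hi1 hi rectCert7_6_6 μ (hev _ rectCertInv7_6_6)
    · exact rect_parity_of_cert7 _ hw1 hw hi1 hi rectCert7_6_7 μ (hev _ rectCertInv7_6_7)
    · exact rect_parity_of_cert7 _ hw1 hw hi1 hi rectCert7_7_1 μ (hev _ rectCertInv7_7_1)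
    · exact rect_parity_of_cert7 _ hw1 hw hi1 hi rectCert7_7_2 μ (hev _ rectCertInv7_7_2)
    · exact rect_parity_of_cert7 _ hw1 hw hi1 hi rectCert7_7_3 μ (hev _ rectCertInv7_7_3)
    · exact rect_parity_of_cert7 _ hw1 hw hi1 hi rectCert7_7_4 μ (hev _ rectCertInv7_7_4)
    · exact rect_parity_of_cert7 _ hw1 hw hi1 hi rectCert7_7_5 μ (hev _ rectCertInv7_7_5)
    · exact rect_parity_of_cert7 _ hw1 hw hi1 hi rectCert7_7_6 μ (hev _ rectCertInv7_7_6)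
    · exact rect_parity_of_cert7 _ hw1 hw hi1 hi rectCert7_7_7 μ (hev _ rectCertInv7_7_7)
  -- the finite lemma
  have hfin := parity_bound7 μ hμ3 hμrow hμcol hrect
  -- the count, from above: Σ_g x g μ[g] ≤ 216
  set Inv := (range 400).filter (fun g => isInv7 g = true) with hInvdef
  have hupper : ∑ g ∈ Inv, (x g : ℤ) * muTr7 x g ≤ 216 := by
    calc ∑ g ∈ Inv, (x g : ℤ) * muTr7 x g ≤ ∑ g ∈ Inv, 2 * (x g : ℤ) := by
          refine sum_le_sum fun g hg => ?_
          have hg' := mem_filter.1 hg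
          obtain ⟨h1, h2⟩ := hloc g (mem_range.1 hg'.1) hg'.2
          exact mul_le_two_mul_of_local7 (hbox g) h1 h2 (sum_nonneg fun i _ => Int.natCast_nonneg _)
      _ = 2 * 108 := by rw [← mul_sum, hInv]
      _ = 216 := by norm_num
  -- the count, from below: Σ_g x g μ[g] = Σ_i Σ_w fiber(w,i) μ(w,i) = 6 Σ μ(3-μ) ≥ 288
  have hlower : ∑ g ∈ Inv, (x g : ℤ) * muTr7 x g = 6 * ((∑ w ∈ range 8, ∑ i ∈ range 8, μ w i * (3 - μ w i) : ℕ) : ℤ) := by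
    have e1 : ∑ g ∈ Inv, (x g : ℤ) * muTr7 x g = ∑ i ∈ range 8, ∑ g ∈ Inv, (x g : ℤ) * (μ (perm7 g i) i : ℤ) := by
      rw [sum_comm]
      refine sum_congr rfl fun g _ => ?_
      rw [hμtr g, mul_sum]
    have e2 : ∀ i ∈ range 8, ∑ g ∈ Inv, (x g : ℤ) * (μ (perm7 g i) i : ℤ)
        = ∑ w ∈ range 8, (18 - 6 * (μ w i : ℤ)) * (μ w i : ℤ) := by
      intro i hi
      rw [sum_graph_fiber7 Inv (fun g => (x g : ℤ)) (fun w i => (μ w i : ℤ)) i]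
      refine sum_congr rfl fun w hw => ?_
      have hset : Inv.filter (fun g => perm7 g i = w) = (range 400).filter (fun g => isInv7 g = true ∧ perm7 g i = w) := by
        ext g; simp [hInvdef, and_assoc]
      rw [hset, hfib w i (mem_range.1 hw) (mem_range.1 hi)]
    rw [e1, sum_congr rfl e2, sum_comm]
    push_cast
    rw [mul_sum]
    refine sum_congr rfl fun w hw => ?_
    rw [mul_sum]
    refine sum_congr rfl fun i hi => ?_
    have h3 := hμ3 w i (mem_range.1 hw) (mem_range.1 hi)
    rw [Nat.cast_sub h3]
    push_cast
    ring
  have hfin' : (48 : ℤ) ≤ ((∑ w ∈ range 8, ∑ i ∈ range 8, μ w i * (3 - μ w i) : ℕ) : ℤ) := by exact_mod_cast hfin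
  linarith

/-- **`R_𝔽₇(⟨2,2,n⟩) ≥ 3n + 4` for every `n ≥ 51`** (one beyond the tree's `3n + 3`, `n ≥ 33`). -/
theorem three_mul_add_four_le_tensorRank_matMulTensor_22n_gf7 (n : ℕ) (hn : 51 ≤ n) :
    3 * n + 4 ≤ tensorRank (matMulTensor (ZMod 7) 2 2 n) :=
  three_mul_add_four_le_of_noTightPoint7 noTightPoint7_3_156 n hn

/-- The same bound for all three orientations `⟨2,2,n⟩`, `⟨2,n,2⟩`, `⟨n,2,2⟩` (`n ≥ 51`). -/
theorem three_mul_add_four_le_tensorRank_matMulTensor_gf7_orientations (n : ℕ) (hn : 51 ≤ n) :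
    3 * n + 4 ≤ tensorRank (matMulTensor (ZMod 7) 2 2 n) ∧ 3 * n + 4 ≤ tensorRank (matMulTensor (ZMod 7) 2 n 2) ∧
      3 * n + 4 ≤ tensorRank (matMulTensor (ZMod 7) n 2 2) :=
  three_mul_add_four_le_orientations_of_noTightPoint7 noTightPoint7_3_156 n hn

/-- Census numeral at the new threshold: `157 ≤ R_𝔽₇(⟨2,2,51⟩)`. -/
theorem tensorRank_matMulTensor_2_2_51_gf7_ge : 157 ≤ tensorRank (matMulTensor (ZMod 7) 2 2 51) :=
  three_mul_add_four_le_tensorRank_matMulTensor_22n_gf7 51 le_rfl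

end Summit.MatrixMultiplication.OmegaCensus.SmallFormats
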